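import Mathlib
import HarnessLib
import Summits.HubbardSuperconductivity.HubbardSuperconductivity.Theorems.KLProgrammeKLRegimeSplitTwoLegSizesFromPosition

/-!
# Route `KLProgramme` — gen-5 ENGINE child, stub `stub_twoLeg_scale0`: (E3a) SIZES of the scale-`0` piece `ℓ_0(K.eval) = E_μ(ν_0(K) − K∘k_F^K)` END TO END
# from the scale-`0` position-space two-leg kernel moments, the frame's `C⁴` sizes and its `C⁴` Fermi-point map

Cell `gate-hubbard-kl`, seat p1b (g6); companion of `…TwoLegSizesFromPosition` (pieces `ℓ_{n+1}`).  At scale `0` the piece subtracts the NORMAL FORM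
`K∘k_F^K` (the frame read on its own curve), so the profile is `δ₀ = (evalM S₀ − evalM K) ∘ γ` with `S₀ = symInterp L (klLocSelfEnergyRe … K 0)`,
`γ = toLp ∘ klFermiPoint μ K`; its momentum-side sizes are `‖Dᵏ evalM S₀‖ + ‖Dᵏ frameShift K‖ ≤ 2Mˢ_k + A′_k` (scale-`0` kernel moments, p485541, plus the
frame's own `C⁴` sizes, e.g. `norm_iteratedFDeriv_frameShift_le_of_frameOK_four`), and the rest is the same assembly (k3c3-p3's composite envelope, k3c3-p1's
`norm_iteratedFDeriv_onM_piece_le` through `klTwoLegPieceFn_eval_zero`):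

* **`norm_iteratedFDeriv_onM_pieceFn_eval_zero_le_of_position_moments`**: for a frame of `C²` size `A` (`2A < Dt_min`, window) with `C⁴` sizes
  `‖Dᵏ frameShift K‖ ≤ A′ k` (`k ≤ 4`), `μ ∈ klWindowC`, `C⁴` Fermi-point map with `‖γ⁽ⁱ⁾‖ ≤ Dⁱ`, scale-`0` moments `Mˢ k` (`k ≤ 4`) and cutoff numerals `X`:
  `‖Dʲ onM ℓ_0(K.eval)(q)‖ ≤ [j=0]·(2Mˢ₀ + A′₀) + (j!)²(2·j!·X·200ʲ)·G₀·(4 + max 1 ((j−1)!/(8/5)))ʲ`, `G₀ = 2m₀ + 7(Σ_{k=1}^{4} m_k)(max D 1)⁴`, `m_k = 2Mˢ_k + A′_k`.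

Everything is PROVED; no definitions; nothing about the model is asserted.  References: BGM 2006 (2.36), §2.4 Lemma 2.1 [cite: BenfattoGiulianiMastropietro2006].
-/

noncomputable section

namespace Summit.HubbardSuperconductivity.HubbardSuperconductivity.Theorems.KLRegimeSplit

set_option linter.dupNamespace false -- summit = problem name (single-conjunct summit), D-0017

open Real Finset
open Literature.MathematicalPhysics.QuantumLattice Literature.MathematicalPhysics.QuantumLattice.BandSectorCounting
open Literature.Probability.LatticeModels
open Summit.HubbardSuperconductivity.HubbardSuperconductivity.Theorems.DispersionFlow
open Summit.HubbardSuperconductivity.HubbardSuperconductivity.Theorems.PerturbedFermiCurve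
open Summit.HubbardSuperconductivity.HubbardSuperconductivity.Theorems.KLProgrammeLegKernels
open Summit.HubbardSuperconductivity.HubbardSuperconductivity.Theorems.TwoLegFourier

section Model

variable {L M : ℕ} [NeZero L] [NeZero M]

/-- **The scale-`0` profile is `(evalM S₀ − evalM K)` read along the Fermi-point map.** -/
theorem klLocalPart_zero_sub_frame_eq_comp (β U μ : ℝ) (K : TrigPolyC4v) :
    (fun θ => klLocalPart L M β U μ K 0 θ - K.eval (klFermiPoint μ K θ)) =
      (fun q : Momentum => evalM (symInterp L (klLocSelfEnergyRe L M β U μ K 0)) q - evalM K q) ∘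
        fun θ => (WithLp.toLp 2 (klFermiPoint μ K θ) : Momentum) := by
  funext θ
  simp only [Function.comp_apply, evalM_apply, klLocalPart]

/-- `‖Dᵏ evalM K‖ = ‖Dᵏ frameShift K‖` (`evalM K = −frameShift K`). -/
theorem norm_iteratedFDeriv_evalM_eq_frameShift (K : TrigPolyC4v) (k : ℕ) (p : Momentum) :
    ‖iteratedFDeriv ℝ k (evalM K) p‖ = ‖iteratedFDeriv ℝ k (frameShift K) p‖ := by
  have h : evalM K = -frameShift K := by funext q; simp [evalM_apply, frameShift]
  rw [h, iteratedFDeriv_neg_apply, norm_neg]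

variable {a b : ℝ} (B : BandBounds a b) {K : TrigPolyC4v} {A : ℝ}
  (hA : ∀ p : Momentum, ∀ j ≤ 2, ‖iteratedFDeriv ℝ j (frameShift K) p‖ ≤ A) (hADt : 2 * A < B.Dtmin)
  {μ : ℝ} (hlo : a ≤ μ - A) (hhi : μ + A ≤ b)
include B hA hADt hlo hhi

/-- **(E3a) SIZES OF `ℓ_0(K.eval)` END TO END FROM THE SCALE-`0` POSITION KERNEL, THE FRAME'S `C⁴` SIZES AND THE CURVE.**  Frame of `C²` size `A`
(`2A < Dt_min`, `[μ − A, μ + A] ⊂ [a, b]`) with `‖Dᵏ frameShift K‖ ≤ A′ k` (`k ≤ 4`); `μ ∈ klWindowC`; `β > 0`; `γ = toLp ∘ klFermiPoint μ K` of class `C⁴`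
with `‖γ⁽ⁱ⁾‖ ≤ Dⁱ`; the scale-`0` unsectorised position two-leg kernels with pinned spatial `k`-th moments `≤ Mˢ k` (`k ≤ 4`, both spins); cutoff
numerals `X`.  Then for `j ≤ 4`:
`‖Dʲ onM (klTwoLegPieceFn L M β U μ K.eval 0) q‖ ≤ [j=0]·(2Mˢ₀ + A′₀) + (j!)²(2·j!·X·200ʲ)·G₀·(4 + max 1 ((j−1)!/(8/5)))ʲ`,
`G₀ = 2(2Mˢ₀ + A′₀) + 7·(Σ_{k ∈ Icc 1 4} (2Mˢ_k + A′_k))·(max D 1)⁴`. [cite: BenfattoGiulianiMastropietro2006, (2.36)] -/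
theorem norm_iteratedFDeriv_onM_pieceFn_eval_zero_le_of_position_moments {β U : ℝ} (hβ : 0 < β) (hμ : μ ∈ klWindowC)
    {A' : ℕ → ℝ} (hA' : ∀ p : Momentum, ∀ k ≤ 4, ‖iteratedFDeriv ℝ k (frameShift K) p‖ ≤ A' k)
    {Ms : ℕ → ℝ}
    (hMs : ∀ k ≤ 4, ∀ (σ : Fin 2) (x₀ : SpaceTimeIdx L M), imagTimeWeight β M *
      ∑ x ∈ (univ : Finset (Fin 2 → SpaceTimeIdx L M)).filter (fun x => x 0 = x₀),
        (1 + ((((x 1).2 - (x 0).2) 0).valMinAbs.natAbs : ℝ) + ((((x 1).2 - (x 0).2) 1).valMinAbs.natAbs : ℝ)) ^ k *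
          ‖sectorisedKernel L M β (trivialMultiplier L M) (klEffectiveAction L M β U μ K klE0 0) 2
            (![((0, σ), 0), ((0, σ), 1)] : Fin 2 → SectorLeg 1) x‖ ≤ Ms k)
    {D : ℝ} (hγ : ContDiff ℝ 4 fun θ => (WithLp.toLp 2 (klFermiPoint μ K θ) : Momentum))
    (hD : ∀ i, 1 ≤ i → i ≤ 4 → ∀ θ : ℝ, ‖iteratedDeriv i (fun θ => (WithLp.toLp 2 (klFermiPoint μ K θ) : Momentum)) θ‖ ≤ D ^ i)
    {j : ℕ} (hj : j ≤ 4) {X : ℝ} (hX : ∀ l ≤ j, ∀ x : ℝ, ‖iteratedFDeriv ℝ l salmhoferCutoff x‖ ≤ X) (q : Momentum) :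
    ‖iteratedFDeriv ℝ j (onM (klTwoLegPieceFn L M β U μ K.eval 0)) q‖ ≤
      (if j = 0 then 2 * Ms 0 + A' 0 else 0) +
        (j.factorial : ℝ) ^ 2 * (2 * j.factorial * X * 200 ^ j) *
          (2 * (2 * Ms 0 + A' 0) + 7 * (∑ k ∈ Icc 1 4, (2 * Ms k + A' k)) * (max D 1) ^ 4) *
            (4 + max 1 (((j - 1).factorial : ℝ) / (8 / 5))) ^ j := by
  set S₀ := symInterp L (klLocSelfEnergyRe L M β U μ K 0) with hS₀
  set F : Momentum → ℝ := fun p => evalM S₀ p - evalM K p with hF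
  set γ : ℝ → Momentum := fun θ => (WithLp.toLp 2 (klFermiPoint μ K θ) : Momentum) with hγdef
  set δ : ℝ → ℝ := fun θ => klLocalPart L M β U μ K 0 θ - K.eval (klFermiPoint μ K θ) with hδ
  have hδF : δ = F ∘ γ := klLocalPart_zero_sub_frame_eq_comp β U μ K
  -- momentum-side sizes of `F`
  have hS : ∀ k ≤ 4, ∀ p : Momentum, ‖iteratedFDeriv ℝ k (evalM S₀) p‖ ≤ 2 * Ms k := fun k hk p =>
    norm_iteratedFDeriv_evalM_symInterp_le_of_moments (sum_weight_abs_torusCosCoeff_klLocSelfEnergyRe_le hβ U μ K 0 k (hMs k hk)) p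
  have hMk : ∀ k ≤ 4, ∀ p : Momentum, ‖iteratedFDeriv ℝ k F p‖ ≤ 2 * Ms k + A' k := fun k hk p => by
    have h1 := hS k hk p
    have h2 : ‖iteratedFDeriv ℝ k (evalM K) p‖ ≤ A' k := by rw [norm_iteratedFDeriv_evalM_eq_frameShift]; exact hA' p k hk
    rw [hF, fun_iteratedFDeriv_sub_apply ((contDiff_evalM S₀).contDiffAt.of_le le_top) ((contDiff_evalM K).contDiffAt.of_le le_top)]
    exact (norm_sub_le _ _).trans (add_le_add h1 h2)
  set m : ℕ → ℝ := fun k => 2 * Ms k + A' k with hm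
  have hm0 : ∀ k ≤ 4, 0 ≤ m k := fun k hk => by
    have := hMk k hk q; exact (norm_nonneg _).trans this
  have hD0 : 0 ≤ D := (norm_nonneg _).trans (by simpa using hD 1 le_rfl (by norm_num) 0)
  have hFc : ContDiff ℝ 4 F := (contDiff_evalM S₀).sub (contDiff_evalM K)
  have hval : ∀ θ, |δ θ| ≤ m 0 := fun θ => by
    rw [hδF, Function.comp_apply, ← Real.norm_eq_abs, ← norm_iteratedFDeriv_zero (𝕜 := ℝ)]
    exact hMk 0 (by norm_num) _
  have hder : ∀ i, 1 ≤ i → i ≤ 4 → ∀ θ, |iteratedDeriv i δ θ| ≤ 7 * (∑ k ∈ Icc 1 i, m k) * D ^ i := fun i hi1 hi4 θ => by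
    rw [hδF]
    exact abs_iteratedDeriv_comp_le_envelope hFc hγ (fun k hk1 hk4 => hMk k hk4 _) (fun i hi1 hi4 => hD i hi1 hi4 θ) hi1 hi4
  have hmean : |klAngularMean δ| ≤ m 0 := abs_klAngularMean_le' hval
  set G : ℝ := 2 * m 0 + 7 * (∑ k ∈ Icc 1 4, m k) * (max D 1) ^ 4 with hGdef
  have hsum4 : 0 ≤ ∑ k ∈ Icc 1 4, m k := sum_nonneg fun k hk => hm0 k (mem_Icc.1 hk).2
  have hDm : D ≤ max D 1 := le_max_left _ _
  have h1m : 1 ≤ max D 1 := le_max_right _ _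
  have hG : ∀ i ≤ j, ∀ t : ℝ, ‖iteratedFDeriv ℝ i (fun t => δ t - klAngularMean δ) t‖ ≤ G := by
    intro i hi t
    have hi4 : i ≤ 4 := hi.trans hj
    rcases Nat.eq_zero_or_pos i with rfl | hipos
    · rw [norm_iteratedFDeriv_zero, Real.norm_eq_abs]
      have h := abs_sub (δ t) (klAngularMean δ)
      have hv := hval t
      have : 0 ≤ 7 * (∑ k ∈ Icc 1 4, m k) * (max D 1) ^ 4 := by positivity
      linarith
    · have hδc : ContDiff ℝ 4 δ := by rw [hδF]; exact hFc.comp hγ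
      have hsub : iteratedFDeriv ℝ i (fun t => δ t - klAngularMean δ) t = iteratedFDeriv ℝ i δ t := by
        rw [fun_iteratedFDeriv_sub_apply (hδc.contDiffAt.of_le (by exact_mod_cast hi4)) contDiffAt_const,
          iteratedFDeriv_const_of_ne (Nat.pos_iff_ne_zero.1 hipos), Pi.zero_apply, sub_zero]
      rw [hsub, norm_iteratedFDeriv_eq_norm_iteratedDeriv, Real.norm_eq_abs]
      refine (hder i hipos hi4 t).trans ?_
      have hsub_sum : ∑ k ∈ Icc 1 i, m k ≤ ∑ k ∈ Icc 1 4, m k :=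
        sum_le_sum_of_subset_of_nonneg (Icc_subset_Icc le_rfl hi4) fun k hk _ => hm0 k (mem_Icc.1 hk).2
      have hDi : D ^ i ≤ (max D 1) ^ 4 := (pow_le_pow_left₀ hD0 hDm i).trans (pow_le_pow_right₀ h1m hi4)
      have h0 : 0 ≤ ∑ k ∈ Icc 1 i, m k := sum_nonneg fun k hk => hm0 k ((mem_Icc.1 hk).2.trans hi4)
      have h7 : 7 * (∑ k ∈ Icc 1 i, m k) * D ^ i ≤ 7 * (∑ k ∈ Icc 1 4, m k) * (max D 1) ^ 4 := by gcongr
      have : 0 ≤ 2 * m 0 := by have := hm0 0 (by norm_num); linarith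
      linarith
  -- the piece as a G-extension of `δ`, and the `H_f` calculus
  have h0c : Continuous (klLocalPart L M β U μ K 0) := (contDiff_klLocalPart B hA hADt hlo hhi L M β U 0 (m := 0)).continuous
  have hKc : Continuous fun θ => K.eval (klFermiPoint μ K θ) := (contDiff_eval_klFermiPoint B hA hADt hlo hhi K (m := 0)).continuous
  have hP := klTwoLegPieceFn_eval_zero (L := L) (M := M) β U μ K h0c hKc
  have hper : Function.Periodic δ (2 * π) := fun θ => by
    simp only [hδ, klLocalPart_periodic β U μ K 0 θ, frameOnCurve_periodic μ K θ]
  have hδc : ContDiff ℝ 4 δ := by rw [hδF]; exact hFc.comp hγ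
  have hmain := norm_iteratedFDeriv_onM_piece_le hP (N := 4) hδc hper (j := j) (by exact_mod_cast hj) hμ hG hX q
  refine hmain.trans (add_le_add ?_ le_rfl)
  split_ifs
  · exact hmean
  · exact le_rfl

end Model

end Summit.HubbardSuperconductivity.HubbardSuperconductivity.Theorems.KLRegimeSplit

end
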